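import Literature.MathematicalPhysics.QuantumFieldTheory.Balaban1983to89.B6BlockHolderCompositesV1
import Literature.MathematicalPhysics.QuantumFieldTheory.Balaban1983to89.B6Prop25GradDecayTwoScaleV1

/-!
# `Balaban1983to89.B6Prop25HolderTwoScaleV1` — T. Bałaban, *Propagators and renormalization transformations for lattice gauge theories. II*,
# Commun. Math. Phys. **96** (1984) 223–250 [Balaban1984PropagatorsII], PROPOSITION 2.5 p. 246, THE HÖLDER MEMBER `‖ζ∇GJ‖_α` OF (1.111) FOR THE
# GENUINE TWO-SCALE `G = Δ_a⁻¹` OF (2.90), `Λ′ ⊂ T^{(j+1)}` ARBITRARY, for `tsV1` at the paper's scaling — file 5 of the Hölder programme (p38),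
# the assembly; the Hölder twin of p22's `B6Prop25GradDecayTwoScaleV1`

statement-level skeleton of published theorems with citation tags; proofs where landed; nothing here is a claim about the Yang–Mills mass gap

p. 246 (Proposition 2.5, verbatim): *"The operator G defined by (2.90) … has the representation (2.129) and satisfies all the inequalities
(1.110)–(1.114) of the Proposition 1.2 with a positive constant δ₂ instead of δ₀. This constant depends on d and L only."*  [4] (1.111) p. 35:
*"‖ζ∇GJ‖_α, ‖ζG∇*J‖_α ≤ O(1)e^{−δ₀|y−y′|}(‖ζ‖_α + |ζ|)|J| for 0 ≤ α < 1, ζ ∈ C^∞(Δ̃(y)), supp J ⊂ Δ̃(y′), with the constant O(1) depending on d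
and α (O(1) → ∞ if α → 1)"*, (1.109): *"‖∇A‖_α = sup_{μ,ν, x,x′: |x−x′| ≤ 1} |x − x′|^{−α}|(∂_μA_ν)(x) − (∂_μA_ν)(x′)|"*.

WHAT THIS FILE DOES.  Differentiating (2.129) (p22's `G_eq_op_V1`) in a fine direction `λ`,
`D_λG = D_λK₁ + (D_λM)(I − K₂) − (D_λK₂*)·M(I − K₂)`, `M = G̃_j + H_jC̃^{(j)}_ΛH_j*`, `D_λ = n(S_λ − I)`; every differentiated FIRST factor has a
uniform PAIR (Hölder-in-the-output) bound (file 4: `holderBound_DK1_scaling`, `holderBound_DK2adj_scaling`, `holderBound_DHjCtHj_scaling`,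
`holderBound_DGt_scaling`) and every undifferentiated factor a uniform block bound (p22 files 3, 5, 6); file 1's pair calculus gives
§1 **`holderBound_DG_scaling`**: for every `d + 1`, `L`, `0 < a₀ ≤ a₁` there is `δ₂ > 0` and for every `0 ≤ α < 1` a `C_α ≥ 0` such that for every
volume, `j + 1 ≤ m + K`, `Λ′`, weights `a₀n^{d+1} ≤ w ≤ a₁n^{d+1}`, direction `λ`, fine bonds `b₁ = ⟨x, ν⟩`, `b₂ = ⟨x′, ν⟩` with `|x − x′|_∞ ≤ n`
(`t = |x − x′|_∞/n ≤ 1`) and unit site `y`: `Σ_{b₀′ : y(b₀′₋) = y}|(D_λG)(e_{b₀′})_{b₁} − (D_λG)(e_{b₀′})_{b₂}| ≤ C_α·t^α·e^{−δ₂(1−α)|y(x) − y|_T}`;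
and §2 THE PRINTED SHAPE **`prop25_ineq111_grad`**: for a cut-off `ζ` on the fine sites supported over the unit sites within `r` of `y`,
`|ζ| ≤ Z₀`, `|ζ(x) − ζ(x′)| ≤ Z_h·t^α`, and `J` supported over the unit sites within `r` of `y′`, `|J| ≤ X`:
`|ζ(x)(∇_λGJ)_ν(x) − ζ(x′)(∇_λGJ)_ν(x′)| ≤ C_α·e^{(1+2δ₂(1−α))(r+1)}·e^{−δ₂(1−α)|y − y′|_T}·(Z_h + Z₀)·|J|·t^α` (file 1's `pairDiff_le_of_support`,
`abs_cutoff_pairDiff_le`; the sup part `|(∇_λGJ)_ν(x)|` is p22's `blockBound_DG_scaling`).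

HONEST SCOPE / DIVERGENCES. (1) The decay RATE is `δ₂(1−α)` with `δ₂ = δ₂(d, L, a₀, a₁)`: the print has `δ₂(d, L)` for all `α` — the
`α`-dependence enters through b05's reading of the Hölder decay (1.63) of `∂H_k` (rate `κ(1−α)/(1+α)`, `B5Hk163TorusHolderDecay`, HONEST LIMITS (i)),
the only Hölder input for `H_j` in the tree; the `G^{(w′)}`-led terms have `α`-free rates ([4] (1.111) BY NAME, p19). (2) Only pairs `x, x′` with
`|x − x′|_∞ ≤ n` (= (1.109)'s `|x − x′| ≤ 1`) and bonds of equal direction `ν`; `∇_λ` = forward difference times `η⁻¹ = L^j`. (3) The member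
`‖ζG∇*J‖_α` and (1.112)–(1.114) are not treated here. (4) `ζ ∈ C^∞(Δ̃(y))`, `supp J ⊂ Δ̃(y′)` are replaced by supports over the unit sites within
`r` of `y`, `y′` (radius-`r` packaging as in p22's (1.110) files, growth `e^{(1+2δ)(r+1)}`). (5) No new definition, no new hypothesis.  v1.2 (p38 gen 23, PROOF-ONLY, statements byte-identical): `holderBound_DG_scaling`
elaborates at the DEFAULT heartbeat budget (v1.0/v1.1: `maxHeartbeats 400000`) — operators read off the factor theorems via `_`, the algebra (d)
through the private generic `comp_left_eq_of_G_eq`, rate/constant bookkeeping by explicit terms, `obtain` for the composite constant instead of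
`set … with` (which rewrites `at *` through the large factor hypotheses).  NOT summit
progress.  Unit `lit-balaban-p38` (gen 21; v1.2 gen 23), 2026-08-22.
-/

noncomputable section

open scoped InnerProductSpace BigOperators
open Finset

namespace Literature.MathematicalPhysics.QuantumFieldTheory.Balaban1983to89.B6Prop25HolderTwoScaleV1

open LatticeFieldCalculus B5SectBStatements B5Eq117TorusCarriers B6SectAOperatorsV1 B6SectCOperators
  B6SectCTwoScaleV1 B6SectCTwoScaleV1Lattice B5Eq118OneStroke
open BalabanImbrieJaffe1984to88.BIJ85AxialPropagator411 (BondSpace)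
open B4Sect5Torus (IsPseudoDist SumBound)
open B4TorusKernel.MultiPeriod (torusSupNorm torusSupNorm_nonneg)
open B4Sect5Proof (latticeConst latticeConst_nonneg)
open B6LowerBound2153Torus (rep)
open B6Repr2129Operator (G_eq_op_V1)
open B6BlockDecayCalculus (blockBound_comp blockBound_add blockBound_sub blockBound_id blockBound_mono abs_apply_le_of_support
  torusDist_isPseudoDist torusDist_sumBound)
open B6BlockDecayHjCovV1 (blockBound_HjCtHj_scaling)
open B6BlockDecayHprimeCovV1 (supDist_cast_eq_torusSupNorm)
open B6BlockDecayK12V1 (blockBound_K2_scaling)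
open B6BlockDecayGtV1 (blockBound_Gt_scaling)
open B6BlockDecayGradFactorsV1 (Dop_comp_apply)
open B6Prop25GradDecayTwoScaleV1 (blockBound_DG_scaling)
open B6BlockHolderCalculus (holderBound_comp holderBound_add holderBound_sub holderBound_mono pairDiff_le_of_support abs_cutoff_pairDiff_le
  self_le_rpow_of_le_one')
open B6BlockHolderCompositesV1 (holderBound_DK1_scaling holderBound_DK2adj_scaling holderBound_DHjCtHj_scaling holderBound_DGt_scaling)
open BalabanImbrieJaffe1984to88.BIJ85Ineq722Torus (supDist_blk_le_one)

variable {d L m K : ℕ} {hd : 1 ≤ d + 1} {hL : Odd L ∧ 1 < L} {j : ℕ}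

/-! ## §1  The pair bound of `D_λG`: Proposition 2.5, the Hölder member `‖ζ∇GJ‖_α` of (1.111), uniformly -/

/-- the operator algebra of (2.129) composed with `∇_λ` on the LEFT (generic, so that no operator of `tsV1` is restated): from
`G = K₁ + (I − K₂)*M(I − K₂)`, `D∘G = D∘K₁ + ((D∘G̃ + D∘HC̃H*)(I − K₂) − (D∘K₂*)(M(I − K₂)))`, `M = G̃ + HC̃H*`.
[cite: Balaban1984PropagatorsII, (2.129)–(2.131) p.246] -/
private theorem comp_left_eq_of_G_eq {V : Type*} [NormedAddCommGroup V] [InnerProductSpace ℝ V] [FiniteDimensional ℝ V]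
    {G K1 K2 Gt HCH D : V →ₗ[ℝ] V}
    (hG : G = K1 + LinearMap.adjoint (LinearMap.id - K2) ∘ₗ (Gt + HCH) ∘ₗ (LinearMap.id - K2)) :
    D ∘ₗ G = D ∘ₗ K1 + ((D ∘ₗ Gt + D ∘ₗ HCH) ∘ₗ (LinearMap.id - K2) -
      (D ∘ₗ LinearMap.adjoint K2) ∘ₗ ((Gt + HCH) ∘ₗ (LinearMap.id - K2))) := by
  rw [hG, map_sub, LinearMap.adjoint_id]
  refine LinearMap.ext fun v => ?_
  simp only [LinearMap.comp_apply, LinearMap.add_apply, LinearMap.sub_apply, LinearMap.id_apply, map_add, map_sub]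
  abel

open Classical in
/-- **PROPOSITION 2.5, THE HÖLDER CONTINUITY OF `∇G` FOR THE TWO-SCALE `G` AS A PAIR BOUND** (at `c = L^j`, weights `a₀n^{d+1} ≤ w ≤ a₁n^{d+1}`):
there is `δ₂ > 0` depending on `d, L, a₀, a₁` only and for every `0 ≤ α < 1` a `C_α ≥ 0` such that for every volume, `j + 1 ≤ m + K`, `Λ′`,
weights in the window, direction `λ`, fine bonds `b₁ = ⟨x, ν⟩`, `b₂ = ⟨x′, ν⟩` with `|x − x′|_∞ ≤ n` and unit site `y`:
`Σ_{b₀′ : y(b₀′₋) = y}|(D_λG)(e_{b₀′})_{b₁} − (D_λG)(e_{b₀′})_{b₂}| ≤ C_α·(|x − x′|_∞/n)^α·e^{−δ₂(1−α)|y(x) − y|_T}` — (2.129) differentiated,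
first factors by their pair bounds (file 4; the Lipschitz ones via `t ≤ t^α`), tails by their block bounds (p22 files 3, 5, 6), composed by file 1.
[cite: Balaban1984PropagatorsII, Prop. 2.5 p.246; Balaban1984PropagatorsI, (1.111) p.35] -/
theorem holderBound_DG_scaling (d L : ℕ) (hd : 1 ≤ d + 1) (hL : Odd L ∧ 1 < L) {a₀ a₁ : ℝ} (ha₀ : 0 < a₀) (ha₁ : a₀ ≤ a₁) :
    ∃ δ : ℝ, 0 < δ ∧ ∀ α : ℝ, 0 ≤ α → α < 1 → ∃ C : ℝ, 0 ≤ C ∧ ∀ (m K : ℕ) (j : ℕ) (hc : ((L : ℝ) ^ j) ≠ 0)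
      (_hj : j + 1 ≤ (⟨d + 1, L, m, K, hd, hL⟩ : Params).m + (⟨d + 1, L, m, K, hd, hL⟩ : Params).K)
      (Λ' : Finset (Site (⟨d + 1, L, m, K, hd, hL⟩ : Params) (j + 1))) (w : CIdx j Λ' → ℝ)
      (_hw0 : ∀ i, a₀ * ((L : ℝ) ^ j) ^ (d + 1) ≤ w i) (_hw1 : ∀ i, w i ≤ a₁ * ((L : ℝ) ^ j) ^ (d + 1)) (lam : Fin (d + 1))
      (b₁ b₂ : PBond (⟨d + 1, L, m, K, hd, hL⟩ : Params) 0) (_hdir : b₁.dir = b₂.dir) (_hle : supDist b₁.src b₂.src ≤ L ^ j) (y : Site (⟨d + 1, L, m, K, hd, hL⟩ : Params) j),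
      ∑ b₀' ∈ univ.filter (fun b₀' : PBond (⟨d + 1, L, m, K, hd, hL⟩ : Params) 0 => iterBlockOf j b₀'.src = y),
          |(((((L : ℝ) ^ j) • (onE (LinearMap.funLeft ℝ ℝ (fun b : PBond (⟨d + 1, L, m, K, hd, hL⟩ : Params) 0 =>
              (⟨b.src.shift lam, b.dir⟩ : PBond (⟨d + 1, L, m, K, hd, hL⟩ : Params) 0))) - LinearMap.id) :
          BondSpace (⟨d + 1, L, m, K, hd, hL⟩ : Params) →ₗ[ℝ] BondSpace (⟨d + 1, L, m, K, hd, hL⟩ : Params))) ∘ₗ (tsV1 hc Λ' w).G) (EuclideanSpace.single b₀' (1 : ℝ)) b₁ -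
           (((((L : ℝ) ^ j) • (onE (LinearMap.funLeft ℝ ℝ (fun b : PBond (⟨d + 1, L, m, K, hd, hL⟩ : Params) 0 =>
              (⟨b.src.shift lam, b.dir⟩ : PBond (⟨d + 1, L, m, K, hd, hL⟩ : Params) 0))) - LinearMap.id) :
          BondSpace (⟨d + 1, L, m, K, hd, hL⟩ : Params) →ₗ[ℝ] BondSpace (⟨d + 1, L, m, K, hd, hL⟩ : Params))) ∘ₗ (tsV1 hc Λ' w).G) (EuclideanSpace.single b₀' (1 : ℝ)) b₂| ≤
        C * (((supDist b₁.src b₂.src : ℕ) : ℝ) / (L : ℝ) ^ j) ^ α * Real.exp (-(δ * (1 - α) * torusSupNorm (Mk (⟨d + 1, L, m, K, hd, hL⟩ : Params) j)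
            (rep (Mk (⟨d + 1, L, m, K, hd, hL⟩ : Params) j) (iterBlockOf j b₁.src) - rep (Mk (⟨d + 1, L, m, K, hd, hL⟩ : Params) j) y))) := by
  obtain ⟨δ₁, hδ₁, C₁, hC₁, hDK1⟩ := holderBound_DK1_scaling d L hd hL
  obtain ⟨δ₂, hδ₂, C₂, hC₂, hK2⟩ := blockBound_K2_scaling d L hd hL
  obtain ⟨δ₃, hδ₃, C₃, hC₃, hDK2a⟩ := holderBound_DK2adj_scaling d L hd hL
  obtain ⟨δ₄, hδ₄, C₄, hC₄, hHCH⟩ := blockBound_HjCtHj_scaling d L hd hL ha₀ ha₁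
  obtain ⟨δ₅, hδ₅, C₅, hC₅, hGt⟩ := blockBound_Gt_scaling d L hd hL
  obtain ⟨δ₆, hδ₆, HDHCH⟩ := holderBound_DHjCtHj_scaling d L hd hL ha₀ ha₁
  obtain ⟨δ₇, hδ₇, HDGt⟩ := holderBound_DGt_scaling d L hd hL
  -- the common `α`-free rate
  set δ₀ : ℝ := min (min (min δ₁ δ₂) (min δ₃ δ₄)) (min (min δ₅ δ₆) δ₇) with hδ₀
  have hδ₀0 : 0 < δ₀ := lt_min (lt_min (lt_min hδ₁ hδ₂) (lt_min hδ₃ hδ₄)) (lt_min (lt_min hδ₅ hδ₆) hδ₇)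
  have h01 : δ₀ ≤ δ₁ := (min_le_left _ _).trans ((min_le_left _ _).trans (min_le_left _ _))
  have h02 : δ₀ ≤ δ₂ := (min_le_left _ _).trans ((min_le_left _ _).trans (min_le_right _ _))
  have h03 : δ₀ ≤ δ₃ := (min_le_left _ _).trans ((min_le_right _ _).trans (min_le_left _ _))
  have h04 : δ₀ ≤ δ₄ := (min_le_left _ _).trans ((min_le_right _ _).trans (min_le_right _ _))
  have h05 : δ₀ ≤ δ₅ := (min_le_right _ _).trans ((min_le_left _ _).trans (min_le_left _ _))
  have h06 : δ₀ ≤ δ₆ := (min_le_right _ _).trans ((min_le_left _ _).trans (min_le_right _ _))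
  have h07 : δ₀ ≤ δ₇ := (min_le_right _ _).trans (min_le_right _ _)
  -- rate bookkeeping, ONCE, by explicit terms (v1.0 re-proved these by `linarith`/`positivity` inside the large context)
  have hh0 : (0 : ℝ) ≤ δ₀ / 2 := div_nonneg hδ₀0.le zero_le_two
  have hh : δ₀ / 2 ≤ δ₀ := div_le_self hδ₀0.le one_le_two
  have hh2 : δ₀ / 2 < δ₀ := div_lt_self hδ₀0 one_lt_two
  have h40 : (0 : ℝ) ≤ δ₀ / 4 := div_nonneg hδ₀0.le zero_le_four
  have h4lt : δ₀ / 4 < δ₀ := div_lt_self hδ₀0 (by norm_num)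
  have hq : δ₀ / 4 ≤ δ₀ := h4lt.le
  have h42 : δ₀ / 4 ≤ δ₀ / 2 := div_le_div_of_nonneg_left hδ₀0.le two_pos (by norm_num)
  set Ka : ℝ := latticeConst (d + 1) (δ₀ - δ₀ / 2) with hKa
  have hKa0 : 0 ≤ Ka := latticeConst_nonneg _ (sub_nonneg.mpr hh)
  have hL0 : 0 < L := by have := hL.2; omega
  have hLp : (0 : ℝ) < L := by exact_mod_cast hL0
  refine ⟨δ₀ / 4, div_pos hδ₀0 four_pos, fun α hα0 hα1 => ?_⟩
  obtain ⟨C₆, hC₆, hDHCH⟩ := HDHCH α hα0 hα1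
  obtain ⟨C₇, hC₇, hDGt⟩ := HDGt α hα0 hα1
  have h1α : 0 < 1 - α := by linarith
  have h1α1 : 1 - α ≤ 1 := by linarith
  have hr0 : 0 < δ₀ * (1 - α) := mul_pos hδ₀0 h1α
  have hδα : 0 ≤ δ₀ * α := mul_nonneg hδ₀0.le hα0
  -- the work rates `δ₀(1−α)`, `δ₀(1−α)/2`, `δ₀(1−α)/4` and their lattice constants
  set Kr2 : ℝ := latticeConst (d + 1) (δ₀ * (1 - α) - δ₀ / 2 * (1 - α)) with hKr2
  set Kr4 : ℝ := latticeConst (d + 1) (δ₀ * (1 - α) - δ₀ / 4 * (1 - α)) with hKr4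
  have hKr20 : 0 ≤ Kr2 := latticeConst_nonneg _ (sub_nonneg.mpr (mul_le_mul_of_nonneg_right hh h1α.le))
  have hKr40 : 0 ≤ Kr4 := latticeConst_nonneg _ (sub_nonneg.mpr (mul_le_mul_of_nonneg_right hq h1α.le))
  -- (`obtain`, not `set`: Mathlib's `set` rewrites `at *` through the large factor hypotheses)
  obtain ⟨C, hC⟩ : ∃ C : ℝ, C = C₁ + ((C₇ + C₆) * (1 + C₂) * Kr2 + C₃ * ((C₅ + C₄) * (1 + C₂) * Ka) * Kr4) := ⟨_, rfl⟩
  have hC0 : 0 ≤ C := by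
    rw [hC]; exact add_nonneg hC₁ (add_nonneg (mul_nonneg (mul_nonneg (add_nonneg hC₇ hC₆) (add_nonneg zero_le_one hC₂)) hKr20)
      (mul_nonneg (mul_nonneg hC₃ (mul_nonneg (mul_nonneg (add_nonneg hC₅ hC₄) (add_nonneg zero_le_one hC₂)) hKa0)) hKr40))
  refine ⟨C, hC0, ?_⟩
  intro m K j hc hj Λ' w hw0 hw1 lam b₁ b₂ hdir hle y
  have hj' : j ≤ m + K := Nat.le_of_succ_le hj
  have hLj : (0 : ℝ) < (L : ℝ) ^ j := pow_pos hLp j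
  have hw : ∀ i, 0 < w i := fun i => lt_of_lt_of_le (mul_pos ha₀ (pow_pos hLj (d + 1))) (hw0 i)
  have ht0 : 0 ≤ (((supDist b₁.src b₂.src : ℕ) : ℝ) / (L : ℝ) ^ j) := div_nonneg (Nat.cast_nonneg _) hLj.le
  have ht1 : (((supDist b₁.src b₂.src : ℕ) : ℝ) / (L : ℝ) ^ j) ≤ 1 := by
    rw [div_le_one hLj]
    exact_mod_cast hle
  have htα : (((supDist b₁.src b₂.src : ℕ) : ℝ) / (L : ℝ) ^ j) ≤ (((supDist b₁.src b₂.src : ℕ) : ℝ) / (L : ℝ) ^ j) ^ α := self_le_rpow_of_le_one' ht0 ht1 hα1.le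
  have htα0 : 0 ≤ (((supDist b₁.src b₂.src : ℕ) : ℝ) / (L : ℝ) ^ j) ^ α := Real.rpow_nonneg ht0 _
  have hρ : IsPseudoDist (fun t t' : Site (⟨d + 1, L, m, K, hd, hL⟩ : Params) j => torusSupNorm (Mk (⟨d + 1, L, m, K, hd, hL⟩ : Params) j) (rep (Mk (⟨d + 1, L, m, K, hd, hL⟩ : Params) j) t - rep (Mk (⟨d + 1, L, m, K, hd, hL⟩ : Params) j) t')) := torusDist_isPseudoDist (Mk (⟨d + 1, L, m, K, hd, hL⟩ : Params) j)
  have hK : SumBound (fun t t' : Site (⟨d + 1, L, m, K, hd, hL⟩ : Params) j => torusSupNorm (Mk (⟨d + 1, L, m, K, hd, hL⟩ : Params) j) (rep (Mk (⟨d + 1, L, m, K, hd, hL⟩ : Params) j) t - rep (Mk (⟨d + 1, L, m, K, hd, hL⟩ : Params) j) t')) (fun a => latticeConst (d + 1) a) := torusDist_sumBound (Mk (⟨d + 1, L, m, K, hd, hL⟩ : Params) j)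
  -- (a) the ingredients: pair bounds at the rate `δ₀(1−α)` (the Lipschitz ones via `t ≤ t^α`; `D_λK₁` directly at `δ₀(1−α)/4`), block bounds at `δ₀`
  have pDK1 := holderBound_mono hρ _ (fun b₀ : PBond (⟨d + 1, L, m, K, hd, hL⟩ : Params) 0 => iterBlockOf j b₀.src) b₁ b₂ (iterBlockOf j b₁.src)
    (C := C₁ * (((supDist b₁.src b₂.src : ℕ) : ℝ) / (L : ℝ) ^ j)) (C' := C₁ * (((supDist b₁.src b₂.src : ℕ) : ℝ) / (L : ℝ) ^ j) ^ α) (mul_nonneg hC₁ htα0) (mul_le_mul_of_nonneg_left htα hC₁)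
    ((mul_le_of_le_one_right h40 h1α1).trans (hq.trans h01)) (hDK1 m K j hc hj Λ' w hw lam b₁ b₂ hdir hle)
  have bK2 := blockBound_mono hρ _ (fun b₀ : PBond (⟨d + 1, L, m, K, hd, hL⟩ : Params) 0 => iterBlockOf j b₀.src) (fun b₀ : PBond (⟨d + 1, L, m, K, hd, hL⟩ : Params) 0 => iterBlockOf j b₀.src)
    hC₂ le_rfl h02 (hK2 m K j hc hj Λ' w hw)
  have pDK2a := holderBound_mono hρ _ (fun b₀ : PBond (⟨d + 1, L, m, K, hd, hL⟩ : Params) 0 => iterBlockOf j b₀.src) b₁ b₂ (iterBlockOf j b₁.src)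
    (C := C₃ * (((supDist b₁.src b₂.src : ℕ) : ℝ) / (L : ℝ) ^ j)) (C' := C₃ * (((supDist b₁.src b₂.src : ℕ) : ℝ) / (L : ℝ) ^ j) ^ α) (mul_nonneg hC₃ htα0) (mul_le_mul_of_nonneg_left htα hC₃)
    ((mul_le_of_le_one_right hδ₀0.le h1α1).trans h03) (hDK2a m K j hc hj Λ' w hw lam b₁ b₂ hdir hle)
  have bHCH := blockBound_mono hρ _
    (fun b₀ : PBond (⟨d + 1, L, m, K, hd, hL⟩ : Params) 0 => iterBlockOf j b₀.src) (fun b₀ : PBond (⟨d + 1, L, m, K, hd, hL⟩ : Params) 0 => iterBlockOf j b₀.src) hC₄ le_rfl h04 (hHCH m K j hc hj Λ' w hw0 hw1)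
  have bGt := blockBound_mono hρ _ (fun b₀ : PBond (⟨d + 1, L, m, K, hd, hL⟩ : Params) 0 => iterBlockOf j b₀.src) (fun b₀ : PBond (⟨d + 1, L, m, K, hd, hL⟩ : Params) 0 => iterBlockOf j b₀.src)
    hC₅ le_rfl h05 (hGt m K j hc hj Λ' w hw)
  have pDHCH := holderBound_mono hρ _
    (fun b₀ : PBond (⟨d + 1, L, m, K, hd, hL⟩ : Params) 0 => iterBlockOf j b₀.src) b₁ b₂ (iterBlockOf j b₁.src) (C' := C₆ * (((supDist b₁.src b₂.src : ℕ) : ℝ) / (L : ℝ) ^ j) ^ α) (mul_nonneg hC₆ htα0) le_rfl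
    (show δ₀ * (1 - α) ≤ δ₆ * (1 - α) from mul_le_mul_of_nonneg_right h06 h1α.le) (hDHCH m K j hc hj Λ' w hw0 hw1 lam b₁ b₂ hdir hle)
  have pDGt := holderBound_mono hρ _
    (fun b₀ : PBond (⟨d + 1, L, m, K, hd, hL⟩ : Params) 0 => iterBlockOf j b₀.src) b₁ b₂ (iterBlockOf j b₁.src) (C' := C₇ * (((supDist b₁.src b₂.src : ℕ) : ℝ) / (L : ℝ) ^ j) ^ α) (mul_nonneg hC₇ htα0) le_rfl
    (show δ₀ * (1 - α) ≤ δ₇ * (1 - α) from mul_le_mul_of_nonneg_right h07 h1α.le) (hDGt m K j hc hj Λ' w hw lam b₁ b₂ hdir hle)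
  have bid := blockBound_id hρ (fun b₀ : PBond (⟨d + 1, L, m, K, hd, hL⟩ : Params) 0 => iterBlockOf j b₀.src) δ₀
  -- (b) `I − K₂`, `M = G̃_j + H_jC̃H_j*`, `D_λM`, `N = M(I − K₂)`, `(D_λM)(I − K₂)`
  have bIK2 := blockBound_sub (ρ := (fun t t' : Site (⟨d + 1, L, m, K, hd, hL⟩ : Params) j => torusSupNorm (Mk (⟨d + 1, L, m, K, hd, hL⟩ : Params) j) (rep (Mk (⟨d + 1, L, m, K, hd, hL⟩ : Params) j) t - rep (Mk (⟨d + 1, L, m, K, hd, hL⟩ : Params) j) t'))) _ _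
    (fun b₀ : PBond (⟨d + 1, L, m, K, hd, hL⟩ : Params) 0 => iterBlockOf j b₀.src) (fun b₀ : PBond (⟨d + 1, L, m, K, hd, hL⟩ : Params) 0 => iterBlockOf j b₀.src) bid bK2
  have bM := blockBound_add (ρ := (fun t t' : Site (⟨d + 1, L, m, K, hd, hL⟩ : Params) j => torusSupNorm (Mk (⟨d + 1, L, m, K, hd, hL⟩ : Params) j) (rep (Mk (⟨d + 1, L, m, K, hd, hL⟩ : Params) j) t - rep (Mk (⟨d + 1, L, m, K, hd, hL⟩ : Params) j) t'))) _ _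
    (fun b₀ : PBond (⟨d + 1, L, m, K, hd, hL⟩ : Params) 0 => iterBlockOf j b₀.src) (fun b₀ : PBond (⟨d + 1, L, m, K, hd, hL⟩ : Params) 0 => iterBlockOf j b₀.src) bGt bHCH
  have pDM := holderBound_add (ρ := (fun t t' : Site (⟨d + 1, L, m, K, hd, hL⟩ : Params) j => torusSupNorm (Mk (⟨d + 1, L, m, K, hd, hL⟩ : Params) j) (rep (Mk (⟨d + 1, L, m, K, hd, hL⟩ : Params) j) t - rep (Mk (⟨d + 1, L, m, K, hd, hL⟩ : Params) j) t'))) _ _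
    (fun b₀ : PBond (⟨d + 1, L, m, K, hd, hL⟩ : Params) 0 => iterBlockOf j b₀.src) b₁ b₂ (iterBlockOf j b₁.src) pDGt pDHCH
  have bN := blockBound_comp hρ hK _ _
    (fun b₀ : PBond (⟨d + 1, L, m, K, hd, hL⟩ : Params) 0 => iterBlockOf j b₀.src) (fun b₀ : PBond (⟨d + 1, L, m, K, hd, hL⟩ : Params) 0 => iterBlockOf j b₀.src) (fun b₀ : PBond (⟨d + 1, L, m, K, hd, hL⟩ : Params) 0 => iterBlockOf j b₀.src)
    (Cf := C₅ + C₄) (Cg := 1 + C₂) (add_nonneg hC₅ hC₄) (add_nonneg zero_le_one hC₂)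
    hh0 hh hh2 bM bIK2
  have pDN := holderBound_comp hρ hK _ _
    (fun b₀ : PBond (⟨d + 1, L, m, K, hd, hL⟩ : Params) 0 => iterBlockOf j b₀.src) (fun b₀ : PBond (⟨d + 1, L, m, K, hd, hL⟩ : Params) 0 => iterBlockOf j b₀.src) b₁ b₂ (iterBlockOf j b₁.src)
    (Cf := C₇ * (((supDist b₁.src b₂.src : ℕ) : ℝ) / (L : ℝ) ^ j) ^ α + C₆ * (((supDist b₁.src b₂.src : ℕ) : ℝ) / (L : ℝ) ^ j) ^ α) (Cg := 1 + C₂) (add_nonneg (mul_nonneg hC₇ htα0) (mul_nonneg hC₆ htα0))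
    (add_nonneg zero_le_one hC₂) (mul_nonneg hh0 h1α.le) ((mul_le_of_le_one_right hh0 h1α1).trans hh)
    (mul_lt_mul_of_pos_right hh2 h1α) pDM bIK2
  -- (c) `(D_λK₂*)·N` and everything at the rate `δ₀(1−α)/4`; the difference; the sum with `D_λK₁`
  have pX := holderBound_comp hρ hK _ _
    (fun b₀ : PBond (⟨d + 1, L, m, K, hd, hL⟩ : Params) 0 => iterBlockOf j b₀.src) (fun b₀ : PBond (⟨d + 1, L, m, K, hd, hL⟩ : Params) 0 => iterBlockOf j b₀.src) b₁ b₂ (iterBlockOf j b₁.src)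
    (Cf := C₃ * (((supDist b₁.src b₂.src : ℕ) : ℝ) / (L : ℝ) ^ j) ^ α) (Cg := (C₅ + C₄) * (1 + C₂) * Ka) (mul_nonneg hC₃ htα0)
    (mul_nonneg (mul_nonneg (add_nonneg hC₅ hC₄) (add_nonneg zero_le_one hC₂)) hKa0)
    (mul_nonneg h40 h1α.le) ((mul_le_of_le_one_right h40 h1α1).trans h42)
    (mul_lt_mul_of_pos_right h4lt h1α) pDK2a bN
  have pDN' := holderBound_mono hρ _
    (fun b₀ : PBond (⟨d + 1, L, m, K, hd, hL⟩ : Params) 0 => iterBlockOf j b₀.src) b₁ b₂ (iterBlockOf j b₁.src)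
    (C' := (C₇ * (((supDist b₁.src b₂.src : ℕ) : ℝ) / (L : ℝ) ^ j) ^ α + C₆ * (((supDist b₁.src b₂.src : ℕ) : ℝ) / (L : ℝ) ^ j) ^ α) * (1 + C₂) * Kr2)
    (mul_nonneg (mul_nonneg (add_nonneg (mul_nonneg hC₇ htα0) (mul_nonneg hC₆ htα0)) (add_nonneg zero_le_one hC₂)) hKr20)
    (le_of_eq (by rw [hKr2]))
    (mul_le_mul_of_nonneg_right h42 h1α.le) pDN
  have pX' := holderBound_mono hρ _
    (fun b₀ : PBond (⟨d + 1, L, m, K, hd, hL⟩ : Params) 0 => iterBlockOf j b₀.src) b₁ b₂ (iterBlockOf j b₁.src)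
    (C' := C₃ * (((supDist b₁.src b₂.src : ℕ) : ℝ) / (L : ℝ) ^ j) ^ α * ((C₅ + C₄) * (1 + C₂) * Ka) * Kr4)
    (mul_nonneg (mul_nonneg (mul_nonneg hC₃ htα0) (mul_nonneg (mul_nonneg (add_nonneg hC₅ hC₄) (add_nonneg zero_le_one hC₂)) hKa0)) hKr40)
    (le_of_eq (by rw [hKr4])) le_rfl pX
  have pY := holderBound_sub (ρ := (fun t t' : Site (⟨d + 1, L, m, K, hd, hL⟩ : Params) j => torusSupNorm (Mk (⟨d + 1, L, m, K, hd, hL⟩ : Params) j) (rep (Mk (⟨d + 1, L, m, K, hd, hL⟩ : Params) j) t - rep (Mk (⟨d + 1, L, m, K, hd, hL⟩ : Params) j) t'))) _ _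
    (fun b₀ : PBond (⟨d + 1, L, m, K, hd, hL⟩ : Params) 0 => iterBlockOf j b₀.src) b₁ b₂ (iterBlockOf j b₁.src) pDN' pX'
  have ptot := holderBound_add (ρ := (fun t t' : Site (⟨d + 1, L, m, K, hd, hL⟩ : Params) j => torusSupNorm (Mk (⟨d + 1, L, m, K, hd, hL⟩ : Params) j) (rep (Mk (⟨d + 1, L, m, K, hd, hL⟩ : Params) j) t - rep (Mk (⟨d + 1, L, m, K, hd, hL⟩ : Params) j) t'))) _ _
    (fun b₀ : PBond (⟨d + 1, L, m, K, hd, hL⟩ : Params) 0 => iterBlockOf j b₀.src) b₁ b₂ (iterBlockOf j b₁.src) pDK1 pY y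
  -- (d) the algebra: `D_λG = D_λK₁ + ((D_λM)(I − K₂) − (D_λK₂*)(M(I − K₂)))` (p22's `G_eq_op_V1` through the generic `comp_left_eq_of_G_eq`)
  rw [comp_left_eq_of_G_eq (G_eq_op_V1 hc hj Λ' hw)]
  refine ptot.trans (le_of_eq ?_)
  rw [hC]
  ring

/-! ## §2  The printed shape: `‖ζ∇GJ‖_α ≤ O(1)e^{−δ₂|y − y′|}(‖ζ‖_α + |ζ|)|J|` -/

open Classical in
/-- **PROPOSITION 2.5, THE MEMBER `‖ζ∇GJ‖_α` OF (1.111) IN THE PRINTED SHAPE** for the genuine two-scale `G` of (2.90), `Λ′` arbitrary (at `c = L^j`,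
weights `a₀n^{d+1} ≤ w ≤ a₁n^{d+1}`): there is `δ₂ > 0` depending on `d, L, a₀, a₁` only and for every `0 ≤ α < 1` a `C_α ≥ 0` such that for every
volume, `j + 1 ≤ m + K`, `Λ′`, weights in the window, direction `λ`, radius `r ≥ 0`, every fine bond field `J` supported on the fine bonds over the unit
sites within `r` of `y′` with `|J| ≤ X`, every cut-off `ζ` on the fine sites supported over the unit sites within `r` of `y` with `|ζ| ≤ Z₀`, and every
pair of fine bonds `b₁ = ⟨x, ν⟩`, `b₂ = ⟨x′, ν⟩` with `|x − x′|_∞ ≤ n` (`t = |x − x′|_∞/n`) and `|ζ(x) − ζ(x′)| ≤ Z_h·t^α`: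
`|ζ(x)·n((GJ)(b₁ + e_λ) − (GJ)(b₁)) − ζ(x′)·n((GJ)(b₂ + e_λ) − (GJ)(b₂))| ≤ C_α·e^{(1+2δ₂(1−α))(r+1)}·e^{−δ₂(1−α)|y − y′|_T}·(Z_h + Z₀)·X·t^α` —
the `α`-Hölder quotient of `ζ∇_λGJ` at scale `≤ 1`, bounded by `(‖ζ‖_α + |ζ|)|J|` with the two-level decay (§1 for the pair part, p22's
`blockBound_DG_scaling` for the sup part, file 1's `abs_cutoff_pairDiff_le`). [cite: Balaban1984PropagatorsII, Prop. 2.5 p.246;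
Balaban1984PropagatorsI, (1.109), (1.111) p.35] -/
theorem prop25_ineq111_grad (d L : ℕ) (hd : 1 ≤ d + 1) (hL : Odd L ∧ 1 < L) {a₀ a₁ : ℝ} (ha₀ : 0 < a₀) (ha₁ : a₀ ≤ a₁) :
    ∃ δ : ℝ, 0 < δ ∧ ∀ α : ℝ, 0 ≤ α → α < 1 → ∃ C : ℝ, 0 ≤ C ∧ ∀ (m K : ℕ) (j : ℕ) (hc : ((L : ℝ) ^ j) ≠ 0)
      (_hj : j + 1 ≤ (⟨d + 1, L, m, K, hd, hL⟩ : Params).m + (⟨d + 1, L, m, K, hd, hL⟩ : Params).K)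
      (Λ' : Finset (Site (⟨d + 1, L, m, K, hd, hL⟩ : Params) (j + 1))) (w : CIdx j Λ' → ℝ)
      (_hw0 : ∀ i, a₀ * ((L : ℝ) ^ j) ^ (d + 1) ≤ w i) (_hw1 : ∀ i, w i ≤ a₁ * ((L : ℝ) ^ j) ^ (d + 1)) (lam : Fin (d + 1))
      (r : ℝ) (_hr : 0 ≤ r) (J : BondSpace (⟨d + 1, L, m, K, hd, hL⟩ : Params)) (X : ℝ) (_hX : 0 ≤ X) (y y' : Site (⟨d + 1, L, m, K, hd, hL⟩ : Params) j)
      (_hsupp : ∀ b : PBond (⟨d + 1, L, m, K, hd, hL⟩ : Params) 0, J b ≠ 0 →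
        torusSupNorm (Mk (⟨d + 1, L, m, K, hd, hL⟩ : Params) j) (rep (Mk (⟨d + 1, L, m, K, hd, hL⟩ : Params) j) (iterBlockOf j b.src) - rep (Mk (⟨d + 1, L, m, K, hd, hL⟩ : Params) j) y') ≤ r)
      (_hJ : ∀ b : PBond (⟨d + 1, L, m, K, hd, hL⟩ : Params) 0, |J b| ≤ X)
      (ζ : Site (⟨d + 1, L, m, K, hd, hL⟩ : Params) 0 → ℝ) (Zh Z0 : ℝ) (_hZh : 0 ≤ Zh) (_hZ0 : 0 ≤ Z0)
      (_hζs : ∀ x : Site (⟨d + 1, L, m, K, hd, hL⟩ : Params) 0, ζ x ≠ 0 →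
        torusSupNorm (Mk (⟨d + 1, L, m, K, hd, hL⟩ : Params) j) (rep (Mk (⟨d + 1, L, m, K, hd, hL⟩ : Params) j) (iterBlockOf j x) - rep (Mk (⟨d + 1, L, m, K, hd, hL⟩ : Params) j) y) ≤ r)
      (_hζ0 : ∀ x : Site (⟨d + 1, L, m, K, hd, hL⟩ : Params) 0, |ζ x| ≤ Z0)
      (b₁ b₂ : PBond (⟨d + 1, L, m, K, hd, hL⟩ : Params) 0) (_hdir : b₁.dir = b₂.dir) (_hle : supDist b₁.src b₂.src ≤ L ^ j)
      (_hζh : |ζ b₁.src - ζ b₂.src| ≤ Zh * (((supDist b₁.src b₂.src : ℕ) : ℝ) / (L : ℝ) ^ j) ^ α),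
      |ζ b₁.src * (((L : ℝ) ^ j) * ((tsV1 hc Λ' w).G J ⟨b₁.src.shift lam, b₁.dir⟩ - (tsV1 hc Λ' w).G J b₁)) -
        ζ b₂.src * (((L : ℝ) ^ j) * ((tsV1 hc Λ' w).G J ⟨b₂.src.shift lam, b₂.dir⟩ - (tsV1 hc Λ' w).G J b₂))| ≤
        C * Real.exp ((1 + 2 * (δ * (1 - α))) * (r + 1)) *
          Real.exp (-(δ * (1 - α) * torusSupNorm (Mk (⟨d + 1, L, m, K, hd, hL⟩ : Params) j) (rep (Mk (⟨d + 1, L, m, K, hd, hL⟩ : Params) j) y - rep (Mk (⟨d + 1, L, m, K, hd, hL⟩ : Params) j) y'))) * (Zh + Z0) * X * (((supDist b₁.src b₂.src : ℕ) : ℝ) / (L : ℝ) ^ j) ^ α := by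
  obtain ⟨δS, hδS, CS, hCS, hS⟩ := blockBound_DG_scaling d L hd hL ha₀ ha₁
  obtain ⟨δH, hδH, HH⟩ := holderBound_DG_scaling d L hd hL ha₀ ha₁
  refine ⟨min δS δH, lt_min hδS hδH, fun α hα0 hα1 => ?_⟩
  obtain ⟨CH, hCH, hH⟩ := HH α hα0 hα1
  have hK10 : 0 ≤ latticeConst (d + 1) 1 := latticeConst_nonneg _ zero_le_one
  refine ⟨(CS + CH) * latticeConst (d + 1) 1, by positivity, ?_⟩
  intro m K j hc hj Λ' w hw0 hw1 lam r hr J X hX y y' hsupp hJ ζ Zh Z0 hZh hZ0 hζs hζ0 b₁ b₂ hdir hle hζh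
  have hj' : j ≤ m + K := Nat.le_of_succ_le hj
  have hL0 : 0 < L := by have := hL.2; omega
  have hLp : (0 : ℝ) < L := by exact_mod_cast hL0
  have hLj : (0 : ℝ) < (L : ℝ) ^ j := by positivity
  have h1α : 0 < 1 - α := by linarith
  set δ' : ℝ := min δS δH * (1 - α) with hδ'
  have hδ'0 : 0 ≤ δ' := mul_nonneg (le_min hδS.le hδH.le) h1α.le
  have hδ'S : δ' ≤ δS := (mul_le_of_le_one_right (le_min hδS.le hδH.le) (by linarith)).trans (min_le_left _ _)
  have hδ'H : δ' ≤ δH * (1 - α) := mul_le_mul_of_nonneg_right (min_le_right _ _) h1α.le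
  have ht0 : 0 ≤ (((supDist b₁.src b₂.src : ℕ) : ℝ) / (L : ℝ) ^ j) := by positivity
  have htα0 : 0 ≤ (((supDist b₁.src b₂.src : ℕ) : ℝ) / (L : ℝ) ^ j) ^ α := Real.rpow_nonneg ht0 _
  have hρ : IsPseudoDist (fun t t' : Site (⟨d + 1, L, m, K, hd, hL⟩ : Params) j => torusSupNorm (Mk (⟨d + 1, L, m, K, hd, hL⟩ : Params) j) (rep (Mk (⟨d + 1, L, m, K, hd, hL⟩ : Params) j) t - rep (Mk (⟨d + 1, L, m, K, hd, hL⟩ : Params) j) t')) := torusDist_isPseudoDist (Mk (⟨d + 1, L, m, K, hd, hL⟩ : Params) j)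
  have hK : SumBound (fun t t' : Site (⟨d + 1, L, m, K, hd, hL⟩ : Params) j => torusSupNorm (Mk (⟨d + 1, L, m, K, hd, hL⟩ : Params) j) (rep (Mk (⟨d + 1, L, m, K, hd, hL⟩ : Params) j) t - rep (Mk (⟨d + 1, L, m, K, hd, hL⟩ : Params) j) t')) (fun a => latticeConst (d + 1) a) := torusDist_sumBound (Mk (⟨d + 1, L, m, K, hd, hL⟩ : Params) j)
  -- the trivial case: both values of the cut-off vanish
  by_cases hz : ζ b₁.src = 0 ∧ ζ b₂.src = 0
  · rw [hz.1, hz.2, zero_mul, zero_mul, sub_zero, abs_zero]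
    positivity
  -- otherwise the anchor `y(x)` is within `r + 1` of `y` (`|y(x) − y(x′)|_T ≤ 1`)
  have hz1 : torusSupNorm (Mk (⟨d + 1, L, m, K, hd, hL⟩ : Params) j) (rep (Mk (⟨d + 1, L, m, K, hd, hL⟩ : Params) j) (iterBlockOf j b₁.src) - rep (Mk (⟨d + 1, L, m, K, hd, hL⟩ : Params) j) y) ≤ r + 1 := by
    rw [not_and_or] at hz
    rcases hz with h1 | h2
    · exact (hζs _ h1).trans (by linarith)
    · have h12 : torusSupNorm (Mk (⟨d + 1, L, m, K, hd, hL⟩ : Params) j) (rep (Mk (⟨d + 1, L, m, K, hd, hL⟩ : Params) j) (iterBlockOf j b₁.src) - rep (Mk (⟨d + 1, L, m, K, hd, hL⟩ : Params) j) (iterBlockOf j b₂.src)) ≤ 1 := by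
        rw [← supDist_cast_eq_torusSupNorm]
        exact_mod_cast supDist_blk_le_one hj' b₁.src b₂.src hle
      calc torusSupNorm (Mk (⟨d + 1, L, m, K, hd, hL⟩ : Params) j) (rep (Mk (⟨d + 1, L, m, K, hd, hL⟩ : Params) j) (iterBlockOf j b₁.src) - rep (Mk (⟨d + 1, L, m, K, hd, hL⟩ : Params) j) y)
          ≤ torusSupNorm (Mk (⟨d + 1, L, m, K, hd, hL⟩ : Params) j) (rep (Mk (⟨d + 1, L, m, K, hd, hL⟩ : Params) j) (iterBlockOf j b₁.src) - rep (Mk (⟨d + 1, L, m, K, hd, hL⟩ : Params) j) (iterBlockOf j b₂.src)) +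
            torusSupNorm (Mk (⟨d + 1, L, m, K, hd, hL⟩ : Params) j) (rep (Mk (⟨d + 1, L, m, K, hd, hL⟩ : Params) j) (iterBlockOf j b₂.src) - rep (Mk (⟨d + 1, L, m, K, hd, hL⟩ : Params) j) y) := hρ.triangle _ _ _
        _ ≤ 1 + r := add_le_add h12 (hζs _ h2)
        _ = r + 1 := add_comm _ _
  -- the sup part `|(∇_λGJ)_ν(x)|` at the rate `δ'` (p22 file 10)
  have bS := blockBound_mono hρ (((((L : ℝ) ^ j) • (onE (LinearMap.funLeft ℝ ℝ (fun b : PBond (⟨d + 1, L, m, K, hd, hL⟩ : Params) 0 =>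
              (⟨b.src.shift lam, b.dir⟩ : PBond (⟨d + 1, L, m, K, hd, hL⟩ : Params) 0))) - LinearMap.id) :
          BondSpace (⟨d + 1, L, m, K, hd, hL⟩ : Params) →ₗ[ℝ] BondSpace (⟨d + 1, L, m, K, hd, hL⟩ : Params))) ∘ₗ (tsV1 hc Λ' w).G)
    (fun b₀ : PBond (⟨d + 1, L, m, K, hd, hL⟩ : Params) 0 => iterBlockOf j b₀.src) (fun b₀ : PBond (⟨d + 1, L, m, K, hd, hL⟩ : Params) 0 => iterBlockOf j b₀.src) hCS le_rfl hδ'S (hS m K j hc hj Λ' w hw0 hw1 lam)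
  have hSx := abs_apply_le_of_support hρ hK (((((L : ℝ) ^ j) • (onE (LinearMap.funLeft ℝ ℝ (fun b : PBond (⟨d + 1, L, m, K, hd, hL⟩ : Params) 0 =>
              (⟨b.src.shift lam, b.dir⟩ : PBond (⟨d + 1, L, m, K, hd, hL⟩ : Params) 0))) - LinearMap.id) :
          BondSpace (⟨d + 1, L, m, K, hd, hL⟩ : Params) →ₗ[ℝ] BondSpace (⟨d + 1, L, m, K, hd, hL⟩ : Params))) ∘ₗ (tsV1 hc Λ' w).G)
    (fun b₀ : PBond (⟨d + 1, L, m, K, hd, hL⟩ : Params) 0 => iterBlockOf j b₀.src) (fun b₀ : PBond (⟨d + 1, L, m, K, hd, hL⟩ : Params) 0 => iterBlockOf j b₀.src) hCS hδ'0 hX bS J y y'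
    (fun k hk => (hsupp k hk).trans (by linarith)) hJ b₁ hz1
  rw [Dop_comp_apply] at hSx
  -- the pair part `|(∇_λGJ)_ν(x) − (∇_λGJ)_ν(x′)|` at the rate `δ'` (§1)
  have pH := holderBound_mono hρ (((((L : ℝ) ^ j) • (onE (LinearMap.funLeft ℝ ℝ (fun b : PBond (⟨d + 1, L, m, K, hd, hL⟩ : Params) 0 =>
              (⟨b.src.shift lam, b.dir⟩ : PBond (⟨d + 1, L, m, K, hd, hL⟩ : Params) 0))) - LinearMap.id) :
          BondSpace (⟨d + 1, L, m, K, hd, hL⟩ : Params) →ₗ[ℝ] BondSpace (⟨d + 1, L, m, K, hd, hL⟩ : Params))) ∘ₗ (tsV1 hc Λ' w).G) (fun b₀ : PBond (⟨d + 1, L, m, K, hd, hL⟩ : Params) 0 => iterBlockOf j b₀.src) b₁ b₂ (iterBlockOf j b₁.src)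
    (C' := CH * (((supDist b₁.src b₂.src : ℕ) : ℝ) / (L : ℝ) ^ j) ^ α) (by positivity) le_rfl hδ'H (hH m K j hc hj Λ' w hw0 hw1 lam b₁ b₂ hdir hle)
  have hHx := pairDiff_le_of_support hρ hK (((((L : ℝ) ^ j) • (onE (LinearMap.funLeft ℝ ℝ (fun b : PBond (⟨d + 1, L, m, K, hd, hL⟩ : Params) 0 =>
              (⟨b.src.shift lam, b.dir⟩ : PBond (⟨d + 1, L, m, K, hd, hL⟩ : Params) 0))) - LinearMap.id) :
          BondSpace (⟨d + 1, L, m, K, hd, hL⟩ : Params) →ₗ[ℝ] BondSpace (⟨d + 1, L, m, K, hd, hL⟩ : Params))) ∘ₗ (tsV1 hc Λ' w).G) (fun b₀ : PBond (⟨d + 1, L, m, K, hd, hL⟩ : Params) 0 => iterBlockOf j b₀.src) b₁ b₂ (iterBlockOf j b₁.src)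
    (by positivity) hδ'0 hX pH J y y' (fun k hk => (hsupp k hk).trans (by linarith)) hJ hz1
  rw [Dop_comp_apply, Dop_comp_apply] at hHx
  -- the cut-off product rule
  refine (abs_cutoff_pairDiff_le hSx hHx hζh (hζ0 b₂.src)).trans ?_
  have hE0 : 0 ≤ (((supDist b₁.src b₂.src : ℕ) : ℝ) / (L : ℝ) ^ j) ^ α * (latticeConst (d + 1) 1 * Real.exp ((1 + 2 * δ') * (r + 1)) *
      Real.exp (-(δ' * torusSupNorm (Mk (⟨d + 1, L, m, K, hd, hL⟩ : Params) j) (rep (Mk (⟨d + 1, L, m, K, hd, hL⟩ : Params) j) y - rep (Mk (⟨d + 1, L, m, K, hd, hL⟩ : Params) j) y')))) * X := by positivity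
  have hcoef : Zh * CS + Z0 * CH ≤ (CS + CH) * (Zh + Z0) := by nlinarith [mul_nonneg hCS hZ0, mul_nonneg hCH hZh]
  calc Zh * (((supDist b₁.src b₂.src : ℕ) : ℝ) / (L : ℝ) ^ j) ^ α * (CS * (latticeConst (d + 1) 1 * Real.exp ((1 + 2 * δ') * (r + 1))) *
          Real.exp (-(δ' * torusSupNorm (Mk (⟨d + 1, L, m, K, hd, hL⟩ : Params) j) (rep (Mk (⟨d + 1, L, m, K, hd, hL⟩ : Params) j) y - rep (Mk (⟨d + 1, L, m, K, hd, hL⟩ : Params) j) y'))) * X) +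
        Z0 * (CH * (((supDist b₁.src b₂.src : ℕ) : ℝ) / (L : ℝ) ^ j) ^ α * (latticeConst (d + 1) 1 * Real.exp ((1 + 2 * δ') * (r + 1))) *
          Real.exp (-(δ' * torusSupNorm (Mk (⟨d + 1, L, m, K, hd, hL⟩ : Params) j) (rep (Mk (⟨d + 1, L, m, K, hd, hL⟩ : Params) j) y - rep (Mk (⟨d + 1, L, m, K, hd, hL⟩ : Params) j) y'))) * X)
        = (Zh * CS + Z0 * CH) * ((((supDist b₁.src b₂.src : ℕ) : ℝ) / (L : ℝ) ^ j) ^ α * (latticeConst (d + 1) 1 * Real.exp ((1 + 2 * δ') * (r + 1)) *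
          Real.exp (-(δ' * torusSupNorm (Mk (⟨d + 1, L, m, K, hd, hL⟩ : Params) j) (rep (Mk (⟨d + 1, L, m, K, hd, hL⟩ : Params) j) y - rep (Mk (⟨d + 1, L, m, K, hd, hL⟩ : Params) j) y')))) * X) := by ring
    _ ≤ (CS + CH) * (Zh + Z0) * ((((supDist b₁.src b₂.src : ℕ) : ℝ) / (L : ℝ) ^ j) ^ α * (latticeConst (d + 1) 1 * Real.exp ((1 + 2 * δ') * (r + 1)) *
          Real.exp (-(δ' * torusSupNorm (Mk (⟨d + 1, L, m, K, hd, hL⟩ : Params) j) (rep (Mk (⟨d + 1, L, m, K, hd, hL⟩ : Params) j) y - rep (Mk (⟨d + 1, L, m, K, hd, hL⟩ : Params) j) y')))) * X) :=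
        mul_le_mul_of_nonneg_right hcoef hE0
    _ = _ := by rw [hδ']; ring

end Literature.MathematicalPhysics.QuantumFieldTheory.Balaban1983to89.B6Prop25HolderTwoScaleV1

end
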